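import Summits.QuantumAdvantage.QuantumAdvantage.Theorems.LinnikCubicClassGroupsDegreeOnePrimesEscapeDivisionNumerics
import Summits.QuantumAdvantage.QuantumAdvantage.Theorems.LinnikCubicClassGroupsDegreeOnePrimesEscapeCubicInertPrimeLemmas
import HarnessLib

/-!
# Thresholds for the Chebotarev–Linnik theorem for Frobenius divisions

Topic `Summits/QuantumAdvantage/QuantumAdvantage/Theorems`, cell B2b-1 (linnik-cubic), PART A (gen 9);
helper toward the crux `DegreeOnePrimesEscape` (stmt-QuantumAdvantage-11543) of route
`LinnikCubicClassGroups`.  HONEST FRAMING: the value of this file is a THEOREM (elementary bookkeeping of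
the exponent `L(n)`) — NOT summit progress.

`division_thresholds`: given `n > 1`, `0 < c₁ ≤ 1`, `X, A ≥ 1`, `L₀`, there is an exponent `L > 0` with
`(1+n²)A ≤ L`, `L₀ ≤ L`, and for every `d ≥ 3`, at `x = d^L`, `W = x c₁/(4 d^{2(1+n²)})`:
`X ≤ x`, `n x^{3/4} ≤ x/(4n²)`, `(n²+n) log d ≤ x/(4n²)`, `n x^{3/4} ≤ W/(4n²)`, `n² log d ≤ W/(4n²)`
(all by `B d^t ≤ d^L` once `t + log_3 B ≤ L`, `mul_rpow_le_rpow_of_logb`).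
-/

noncomputable section

open Finset Real

namespace Summit.QuantumAdvantage.QuantumAdvantage.Theorems.DegreeOnePrimesEscape

set_option maxHeartbeats 800000 in
/-- **The exponent of the Chebotarev–Linnik theorem for divisions** (see the module docstring). -/
theorem division_thresholds (n : ℕ) (hn : 1 < n) {c₁ X A : ℝ} (L₀ : ℝ) (hc₁ : 0 < c₁) (hc₁1 : c₁ ≤ 1)
    (hX1 : 1 ≤ X) (hA1 : 1 ≤ A) :
    ∃ L : ℝ, 0 < L ∧ ((1 : ℝ) + n * n) * A ≤ L ∧ L₀ ≤ L ∧ ∀ d : ℝ, 3 ≤ d →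
      X ≤ d ^ L ∧
      (n : ℝ) * (d ^ L) ^ (3 / 4 : ℝ) ≤ d ^ L / (4 * n ^ 2) ∧
      ((n : ℝ) ^ 2 + n) * Real.log d ≤ d ^ L / (4 * n ^ 2) ∧
      (n : ℝ) * (d ^ L) ^ (3 / 4 : ℝ) ≤ (d ^ L * c₁ / (4 * d ^ (2 * ((1 : ℝ) + n * n)))) / (4 * n ^ 2) ∧
      (n : ℝ) ^ 2 * Real.log d ≤ (d ^ L * c₁ / (4 * d ^ (2 * ((1 : ℝ) + n * n)))) / (4 * n ^ 2) := by
  have hn0 : (0 : ℝ) < n := by exact_mod_cast (lt_trans Nat.zero_lt_one hn)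
  have hn1 : (1 : ℝ) ≤ n := by exact_mod_cast hn.le
  set e : ℝ := (1 : ℝ) + n * n with he
  have he1 : 1 ≤ e := by rw [he]; nlinarith
  set X' : ℝ := max X ((4 * (n : ℝ) ^ 3) ^ 4) with hX'
  have hX'1 : 1 ≤ X' := le_trans hX1 (le_max_left _ _)
  set B₃ : ℝ := 4 * (n : ℝ) ^ 2 * ((n : ℝ) ^ 2 + n) with hB₃
  have hB₃1 : 1 ≤ B₃ := by rw [hB₃]; nlinarith [pow_le_pow_left₀ zero_le_one hn1 2]
  set B₅ : ℝ := (16 * (n : ℝ) ^ 3 / c₁) ^ 4 with hB₅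
  have hB₅1 : 1 ≤ B₅ := by
    rw [hB₅]; apply one_le_pow₀
    rw [le_div_iff₀ hc₁]; nlinarith [pow_le_pow_left₀ zero_le_one hn1 3]
  set B₆ : ℝ := 16 * (n : ℝ) ^ 4 / c₁ with hB₆
  have hB₆1 : 1 ≤ B₆ := by rw [hB₆, le_div_iff₀ hc₁]; nlinarith [pow_le_pow_left₀ zero_le_one hn1 4]
  set L : ℝ := max (max (e * A) L₀) (max (max (Real.logb 3 X') (1 + Real.logb 3 B₃))
    (max (8 * e + Real.logb 3 B₅) (2 * e + 1 + Real.logb 3 B₆))) with hL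
  have hL1 : e * A ≤ L := le_trans (le_max_left _ _) (le_max_left _ _)
  have hL2 : L₀ ≤ L := le_trans (le_max_right _ _) (le_max_left _ _)
  have hL3 : Real.logb 3 X' ≤ L := le_trans (le_trans (le_max_left _ _) (le_max_left _ _)) (le_max_right _ _)
  have hL4 : 1 + Real.logb 3 B₃ ≤ L :=
    le_trans (le_trans (le_max_right _ _) (le_max_left _ _)) (le_max_right _ _)
  have hL5 : 8 * e + Real.logb 3 B₅ ≤ L :=
    le_trans (le_trans (le_max_left _ _) (le_max_right _ _)) (le_max_right _ _)
  have hL6 : 2 * e + 1 + Real.logb 3 B₆ ≤ L :=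
    le_trans (le_trans (le_max_right _ _) (le_max_right _ _)) (le_max_right _ _)
  have hLpos : 0 < L := lt_of_lt_of_le (by nlinarith) hL1
  refine ⟨L, hLpos, hL1, hL2, fun d hd3 => ?_⟩
  have hd0 : (0 : ℝ) < d := by linarith
  have hlogd : Real.log d ≤ d := (Real.log_le_sub_one_of_pos hd0).trans (by linarith)
  set x : ℝ := d ^ L with hx
  have hx0 : 0 < x := Real.rpow_pos_of_pos hd0 L
  have hX'x : X' ≤ x := by
    have h := mul_rpow_le_rpow_of_logb hd3 hX'1 (show (0 : ℝ) + Real.logb 3 X' ≤ L by linarith)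
    rwa [Real.rpow_zero, mul_one] at h
  have hXx : X ≤ x := le_trans (le_max_left _ _) hX'x
  have hB₄x : (4 * (n : ℝ) ^ 3) ^ 4 ≤ x := le_trans (le_max_right _ _) hX'x
  have hB₃x : B₃ * d ≤ x := by
    have h := mul_rpow_le_rpow_of_logb hd3 hB₃1 hL4; rwa [Real.rpow_one] at h
  have hB₅x : B₅ * d ^ (8 * e) ≤ x := mul_rpow_le_rpow_of_logb hd3 hB₅1 hL5
  have hB₆x : B₆ * d ^ (2 * e + 1) ≤ x := mul_rpow_le_rpow_of_logb hd3 hB₆1 hL6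
  have hjunkA : (n : ℝ) * x ^ (3 / 4 : ℝ) ≤ x / (4 * n ^ 2) := by
    have h := mul_rpow_three_quarters_le (B := 4 * (n : ℝ) ^ 3) (by positivity) hx0 hB₄x
    rw [le_div_iff₀ (by positivity)]
    have e1 : (n : ℝ) * x ^ (3 / 4 : ℝ) * (4 * n ^ 2) = 4 * n ^ 3 * x ^ (3 / 4 : ℝ) := by ring
    rw [e1]; exact h
  have hlogj : ((n : ℝ) ^ 2 + n) * Real.log d ≤ x / (4 * n ^ 2) := by
    have : ((n : ℝ) ^ 2 + n) * Real.log d ≤ ((n : ℝ) ^ 2 + n) * d :=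
      mul_le_mul_of_nonneg_left hlogd (by positivity)
    rw [le_div_iff₀ (by positivity)]
    have e3 : B₃ * d = 4 * n ^ 2 * (((n : ℝ) ^ 2 + n) * d) := by rw [hB₃]; ring
    nlinarith
  set W : ℝ := x * c₁ / (4 * d ^ (2 * e)) with hWdef
  have hde0 : 0 < d ^ (2 * e) := by positivity
  have hj1 : (n : ℝ) * x ^ (3 / 4 : ℝ) ≤ W / (4 * n ^ 2) := by
    have h8e : d ^ (8 * e) = (d ^ (2 * e)) ^ 4 := by
      rw [← Real.rpow_natCast, ← Real.rpow_mul hd0.le]; ring_nf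
    have hB : (16 * (n : ℝ) ^ 3 * d ^ (2 * e) / c₁) ^ 4 ≤ x := by
      calc (16 * (n : ℝ) ^ 3 * d ^ (2 * e) / c₁) ^ 4 = B₅ * d ^ (8 * e) := by
            rw [hB₅, h8e]; ring
        _ ≤ x := hB₅x
    have h := mul_rpow_three_quarters_le (B := 16 * (n : ℝ) ^ 3 * d ^ (2 * e) / c₁) (by positivity) hx0 hB
    rw [hWdef, div_div, le_div_iff₀ (by positivity)]
    rw [div_mul_eq_mul_div, div_le_iff₀ hc₁] at h
    have e1 : (n : ℝ) * x ^ (3 / 4 : ℝ) * (4 * d ^ (2 * e) * (4 * n ^ 2)) =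
        16 * n ^ 3 * d ^ (2 * e) * x ^ (3 / 4 : ℝ) := by ring
    rw [e1]; exact h
  have hj2 : (n : ℝ) ^ 2 * Real.log d ≤ W / (4 * n ^ 2) := by
    rw [hWdef, div_div, le_div_iff₀ (by positivity)]
    have e6 : B₆ * d ^ (2 * e + 1) = 16 * n ^ 4 * (d ^ (2 * e) * d) / c₁ := by
      rw [hB₆, Real.rpow_add hd0, Real.rpow_one]; ring
    have h5 : 16 * (n : ℝ) ^ 4 * (d ^ (2 * e) * d) ≤ x * c₁ := by
      have := hB₆x; rw [e6, div_le_iff₀ hc₁] at this; exact this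
    have h6 : 16 * (n : ℝ) ^ 4 * d ^ (2 * e) * Real.log d ≤ 16 * n ^ 4 * d ^ (2 * e) * d :=
      mul_le_mul_of_nonneg_left hlogd (by positivity)
    have e7 : (n : ℝ) ^ 2 * Real.log d * (4 * d ^ (2 * e) * (4 * n ^ 2)) =
        16 * n ^ 4 * d ^ (2 * e) * Real.log d := by ring
    have e8 : 16 * (n : ℝ) ^ 4 * (d ^ (2 * e) * d) = 16 * n ^ 4 * d ^ (2 * e) * d := by ring
    rw [e7]; linarith
  exact ⟨hXx, hjunkA, hlogj, hj1, hj2⟩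

end Summit.QuantumAdvantage.QuantumAdvantage.Theorems.DegreeOnePrimesEscape

end
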